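import Summits.Ventures.CertifiedManyBodySolver.Observables.SourcedGibbsTrialCapKSpaceSymbol
import Literature.MathematicalPhysics.QuantumLattice.HeisenbergOrderNeelInfrared
import HarnessLib

/-!
# The HF–BCS sourced cap in momentum space (X): the Nambu symbol of the ANTIFERROMAGNETIC (staggered-field) +
# `d`-wave-pinned torus on plane waves — `4 × 4` blocks over momentum pairs `(p, p+Q)` whose SQUARE is
# `2 × 2`-block-diagonal

HONEST FRAMING: zero compute; every statement is a PROVED finite-volume identity about the one-body Nambu matrix of
the spin-density-wave + `d`-wave-pinned quasi-free TRIAL Hamiltonian of `Observables/SourcedGibbsTrialCapSpinTrial.lean`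
(`𝓗 = 𝓗_{L,μ',h} + diag(M·(−1)^x)`, even side `L = 2k`); no number is claimed; the staggered field is a variational device;
not a statement about order; not a superconductivity verdict.

Cell `hubbard-obs` (D-0042 / D-0082), seat `hubbard-obs-pin-2` (`prover-hubbard-obs-pin-2-g7-0`). With `Q = (π, π)`
(`neelIndex (2k)`), `ξ_p = ε_L(p) − μ'`, `g_p = 2√2·h·ĝ_d(p)`, plane waves `χ_p ⊗ e_τ` (`planeWave p τ`):

* §1 `torusBand_add_neelIndex`, `dWaveGap_add_neelIndex`, `add_neelIndex_add_neelIndex` (`ε_{p+Q} = −ε_p`,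
  `ĝ_d(p+Q) = −ĝ_d(p)`, `p + Q + Q = p`), `diagonal_neelSign_mulVec_planeWave` (the staggered field maps
  `χ_p ⊗ e_τ ↦ M·χ_{p+Q} ⊗ e_τ`).
* §2 `afNambu_mulVec_planeWave_zero/one`: `𝓗(χ_p ⊗ e_↑) = ξ_p χ_p⊗e_↑ + g_p χ_p⊗e_↓ + M χ_{p+Q}⊗e_↑`,
  `𝓗(χ_p ⊗ e_↓) = g_p χ_p⊗e_↑ − ξ_p χ_p⊗e_↓ + M χ_{p+Q}⊗e_↓` — the `4 × 4` block on `(p, p+Q) × (↑, ↓)`.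
* §3 `afNambu_sq_mulVec_planeWave_zero/one`: **`𝓗²(χ_p ⊗ e_↑) = (ξ_p² + g_p² + M²)·χ_p⊗e_↑ − 2μ'M·χ_{p+Q}⊗e_↑`**,
  **`𝓗²(χ_p ⊗ e_↓) = (ξ_p² + g_p² + M²)·χ_p⊗e_↓ + 2μ'M·χ_{p+Q}⊗e_↓`** — the square does not mix `↑/↓`: on each spin
  sheet it is the real symmetric `2 × 2` block `[[a_p, ∓2μ'M], [∓2μ'M, a_{p+Q}]]` whose eigenvalues are
  `E_±(p)² = (√(ε_p² + M²) ± μ')² + g_p²` (the closed form of the spin-density-wave + BCS quasiparticle spectrum at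
  `t' = 0`); its eigenvectors feed `fermi_mulVec_of_sq_eigen` (file (IX)) — the successor file of this chain.

References: V. Bach, E. H. Lieb, J. P. Solovej, J. Stat. Phys. 76 (1994) 3, §2 [BachLiebSolovej1994]; J. E. Hirsch,
Phys. Rev. B 31 (1985) 4403 [HirschPRB1985]; T. Kennedy, E. H. Lieb, B. S. Shastry, J. Stat. Phys. 53 (1988) 1019, p. 1021
(the Néel point `Q`) [KLS1988JSP]; Scalapino, Phys. Rep. 250 (1995) 329, §2 [Scalapino1995].
-/

noncomputable section

open Matrix Finset Literature.MathematicalPhysics.QuantumLattice Literature.Probability.LatticeModels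
open scoped ComplexConjugate

namespace Summit.Ventures.CertifiedManyBodySolver.Observables

section AFSymbol

variable (k : ℕ) [NeZero (2 * k)]

/-! ### §1 The Néel shift on the band, the gap and the plane waves -/

omit [NeZero (2 * k)] in
/-- `p + Q + Q = p` on the even torus. [folklore] -/
theorem add_neelIndex_add_neelIndex (p : TorusSite 2 (2 * k)) :
    p + neelIndex (2 * k) + neelIndex (2 * k) = p := by
  have h := neg_add_cancel (neelIndex (2 * k) : TorusSite 2 (2 * k))
  rw [neg_neelIndex k] at h
  rw [add_assoc, h, add_zero]

/-- **The band flips under the Néel shift**: `ε_{2k}(p + Q) = −ε_{2k}(p)` (`cos(θ + π) = −cos θ`).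
[cite: KLS1988JSP, p. 1022] -/
theorem torusBand_add_neelIndex (p : TorusSite 2 (2 * k)) :
    torusBand (2 * k) (p + neelIndex (2 * k)) = -torusBand (2 * k) p := by
  have hsub : p + neelIndex (2 * k) = p - neelIndex (2 * k) := by
    rw [sub_eq_add_neg, neg_neelIndex k]
  unfold torusBand
  rw [hsub, Fin.sum_univ_two, Fin.sum_univ_two, cos_latticeMomentum_sub_neelIndex k p 0,
    cos_latticeMomentum_sub_neelIndex k p 1]
  ring

/-- **The `d`-wave form factor flips under the Néel shift**: `ĝ_d(p + Q) = −ĝ_d(p)`. [cite: Scalapino1995, §2] -/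
theorem dWaveGap_add_neelIndex (p : TorusSite 2 (2 * k)) :
    dWaveGap (p + neelIndex (2 * k)) = -dWaveGap p := by
  have hsub : p + neelIndex (2 * k) = p - neelIndex (2 * k) := by
    rw [sub_eq_add_neg, neg_neelIndex k]
  unfold dWaveGap
  rw [hsub, cos_latticeMomentum_sub_neelIndex k p 0, cos_latticeMomentum_sub_neelIndex k p 1]
  ring

/-- `χ_{p+Q}(z) = (−1)^z χ_p(z)` in `torusChar` form. [folklore] -/
theorem torusChar_add_neelIndex' (p z : TorusSite 2 (2 * k)) :
    torusChar (p + neelIndex (2 * k)) z = (neelSign z : ℂ) * torusChar p z := by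
  unfold torusChar
  exact torusChar_add_neelIndex k p z

/-- **The staggered field on plane waves**: `diag((x,σ) ↦ M·(−1)^x) (χ_p ⊗ e_τ) = M·(χ_{p+Q} ⊗ e_τ)`.
[cite: KLS1988JSP, p. 1021] -/
theorem diagonal_neelSign_mulVec_planeWave (M : ℝ) (p : TorusSite 2 (2 * k)) (τ : Fin 2) :
    diagonal (fun i : Orb (FermionTorus 2 (2 * k)) => ((M * neelSign ((ofLex i).1.toTorusSite) : ℝ) : ℂ)) *ᵥ
        planeWave p τ = (M : ℂ) • planeWave (p + neelIndex (2 * k)) τ := by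
  funext o
  obtain ⟨⟨x, σ⟩, rfl⟩ : ∃ q : FermionTorus 2 (2 * k) × Fin 2, toLex q = o := ⟨ofLex o, toLex_ofLex o⟩
  change (_ *ᵥ planeWave p τ) (orb x σ) = ((M : ℂ) • planeWave (p + neelIndex (2 * k)) τ) (orb x σ)
  rw [mulVec_diagonal, Pi.smul_apply, planeWave_orb, planeWave_orb, smul_eq_mul]
  simp only [ofLex_orb]
  split_ifs with h
  · rw [torusChar_add_neelIndex']; push_cast; ring
  · simp

/-! ### §2 The `4 × 4` Nambu symbol of the antiferromagnetic + `d`-wave-pinned torus -/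

/-- **Particle component**: `𝓗_AF (χ_p ⊗ e_↑) = ξ_p (χ_p ⊗ e_↑) + g_p (χ_p ⊗ e_↓) + M (χ_{p+Q} ⊗ e_↑)`
(`2k ≥ 3`). [cite: BachLiebSolovej1994, §2] [cite: HirschPRB1985] -/
theorem afNambu_mulVec_planeWave_zero (hL : 3 ≤ 2 * k) (μ' h M : ℝ) (p : TorusSite 2 (2 * k)) :
    (bdgNambuMatrix
        (fun x y => if (fermionTorusGraph 2 (2 * k)).Adj x y then -(1 : ℂ) else 0)
        (fun u v : FermionTorus 2 (2 * k) => -(h : ℂ) * ∑ i : Fin 2,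
          if v = FermionTorus.ofTorusSite (u.toTorusSite + Pi.single i 1) then
            ((Real.sqrt 2 * (if i = 0 then 1 else -1) : ℝ) : ℂ) else 0) μ' +
      diagonal fun i : Orb (FermionTorus 2 (2 * k)) => ((M * neelSign ((ofLex i).1.toTorusSite) : ℝ) : ℂ)) *ᵥ
        planeWave p 0 =
      ((torusBand (2 * k) p - μ' : ℝ) : ℂ) • planeWave p 0 +
        ((2 * Real.sqrt 2 * h * dWaveGap p : ℝ) : ℂ) • planeWave p 1 +
        (M : ℂ) • planeWave (p + neelIndex (2 * k)) 0 := by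
  rw [Matrix.add_mulVec, dWaveNambu_mulVec_planeWave_zero hL μ' h p, diagonal_neelSign_mulVec_planeWave k M p 0]

/-- **Hole component**: `𝓗_AF (χ_p ⊗ e_↓) = g_p (χ_p ⊗ e_↑) − ξ_p (χ_p ⊗ e_↓) + M (χ_{p+Q} ⊗ e_↓)` (`2k ≥ 3`).
[cite: BachLiebSolovej1994, §2] [cite: HirschPRB1985] -/
theorem afNambu_mulVec_planeWave_one (hL : 3 ≤ 2 * k) (μ' h M : ℝ) (p : TorusSite 2 (2 * k)) :
    (bdgNambuMatrix
        (fun x y => if (fermionTorusGraph 2 (2 * k)).Adj x y then -(1 : ℂ) else 0)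
        (fun u v : FermionTorus 2 (2 * k) => -(h : ℂ) * ∑ i : Fin 2,
          if v = FermionTorus.ofTorusSite (u.toTorusSite + Pi.single i 1) then
            ((Real.sqrt 2 * (if i = 0 then 1 else -1) : ℝ) : ℂ) else 0) μ' +
      diagonal fun i : Orb (FermionTorus 2 (2 * k)) => ((M * neelSign ((ofLex i).1.toTorusSite) : ℝ) : ℂ)) *ᵥ
        planeWave p 1 =
      ((2 * Real.sqrt 2 * h * dWaveGap p : ℝ) : ℂ) • planeWave p 0 -
        ((torusBand (2 * k) p - μ' : ℝ) : ℂ) • planeWave p 1 +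
        (M : ℂ) • planeWave (p + neelIndex (2 * k)) 1 := by
  rw [Matrix.add_mulVec, dWaveNambu_mulVec_planeWave_one hL μ' h p, diagonal_neelSign_mulVec_planeWave k M p 1]

/-! ### §3 The square of the Nambu matrix is `2 × 2`-block-diagonal on each spin sheet -/

/-- **The square on the particle sheet**: `𝓗_AF²(χ_p ⊗ e_↑) = (ξ_p² + g_p² + M²)(χ_p ⊗ e_↑) − 2μ'M (χ_{p+Q} ⊗ e_↑)` —
the `↓`-components cancel (`ξ_p g_p − g_p ξ_p = 0`, `M g_p + M g_{p+Q} = 0`) and `M(ξ_p + ξ_{p+Q}) = −2μ'M`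
(`ε_{p+Q} = −ε_p`). [cite: BachLiebSolovej1994, §2] [cite: HirschPRB1985] -/
theorem afNambu_sq_mulVec_planeWave_zero (hL : 3 ≤ 2 * k) (μ' h M : ℝ) (p : TorusSite 2 (2 * k)) :
    (bdgNambuMatrix
        (fun x y => if (fermionTorusGraph 2 (2 * k)).Adj x y then -(1 : ℂ) else 0)
        (fun u v : FermionTorus 2 (2 * k) => -(h : ℂ) * ∑ i : Fin 2,
          if v = FermionTorus.ofTorusSite (u.toTorusSite + Pi.single i 1) then
            ((Real.sqrt 2 * (if i = 0 then 1 else -1) : ℝ) : ℂ) else 0) μ' +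
      diagonal fun i : Orb (FermionTorus 2 (2 * k)) => ((M * neelSign ((ofLex i).1.toTorusSite) : ℝ) : ℂ)) *ᵥ
      ((bdgNambuMatrix
        (fun x y => if (fermionTorusGraph 2 (2 * k)).Adj x y then -(1 : ℂ) else 0)
        (fun u v : FermionTorus 2 (2 * k) => -(h : ℂ) * ∑ i : Fin 2,
          if v = FermionTorus.ofTorusSite (u.toTorusSite + Pi.single i 1) then
            ((Real.sqrt 2 * (if i = 0 then 1 else -1) : ℝ) : ℂ) else 0) μ' +
      diagonal fun i : Orb (FermionTorus 2 (2 * k)) => ((M * neelSign ((ofLex i).1.toTorusSite) : ℝ) : ℂ)) *ᵥ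
        planeWave p 0) =
      (((torusBand (2 * k) p - μ') ^ 2 + (2 * Real.sqrt 2 * h * dWaveGap p) ^ 2 + M ^ 2 : ℝ) : ℂ) • planeWave p 0 +
        ((-(2 * μ' * M) : ℝ) : ℂ) • planeWave (p + neelIndex (2 * k)) 0 := by
  rw [afNambu_mulVec_planeWave_zero k hL, Matrix.mulVec_add, Matrix.mulVec_add, Matrix.mulVec_smul, Matrix.mulVec_smul,
    Matrix.mulVec_smul, afNambu_mulVec_planeWave_zero k hL, afNambu_mulVec_planeWave_one k hL,
    afNambu_mulVec_planeWave_zero k hL, torusBand_add_neelIndex, dWaveGap_add_neelIndex, add_neelIndex_add_neelIndex]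
  ext o
  simp only [Pi.add_apply, Pi.smul_apply, Pi.sub_apply, smul_eq_mul]
  push_cast
  ring

/-- **The square on the hole sheet**: `𝓗_AF²(χ_p ⊗ e_↓) = (ξ_p² + g_p² + M²)(χ_p ⊗ e_↓) + 2μ'M (χ_{p+Q} ⊗ e_↓)`.
[cite: BachLiebSolovej1994, §2] [cite: HirschPRB1985] -/
theorem afNambu_sq_mulVec_planeWave_one (hL : 3 ≤ 2 * k) (μ' h M : ℝ) (p : TorusSite 2 (2 * k)) :
    (bdgNambuMatrix
        (fun x y => if (fermionTorusGraph 2 (2 * k)).Adj x y then -(1 : ℂ) else 0)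
        (fun u v : FermionTorus 2 (2 * k) => -(h : ℂ) * ∑ i : Fin 2,
          if v = FermionTorus.ofTorusSite (u.toTorusSite + Pi.single i 1) then
            ((Real.sqrt 2 * (if i = 0 then 1 else -1) : ℝ) : ℂ) else 0) μ' +
      diagonal fun i : Orb (FermionTorus 2 (2 * k)) => ((M * neelSign ((ofLex i).1.toTorusSite) : ℝ) : ℂ)) *ᵥ
      ((bdgNambuMatrix
        (fun x y => if (fermionTorusGraph 2 (2 * k)).Adj x y then -(1 : ℂ) else 0)
        (fun u v : FermionTorus 2 (2 * k) => -(h : ℂ) * ∑ i : Fin 2,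
          if v = FermionTorus.ofTorusSite (u.toTorusSite + Pi.single i 1) then
            ((Real.sqrt 2 * (if i = 0 then 1 else -1) : ℝ) : ℂ) else 0) μ' +
      diagonal fun i : Orb (FermionTorus 2 (2 * k)) => ((M * neelSign ((ofLex i).1.toTorusSite) : ℝ) : ℂ)) *ᵥ
        planeWave p 1) =
      (((torusBand (2 * k) p - μ') ^ 2 + (2 * Real.sqrt 2 * h * dWaveGap p) ^ 2 + M ^ 2 : ℝ) : ℂ) • planeWave p 1 +
        ((2 * μ' * M : ℝ) : ℂ) • planeWave (p + neelIndex (2 * k)) 1 := by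
  rw [afNambu_mulVec_planeWave_one k hL, Matrix.mulVec_add, Matrix.mulVec_sub, Matrix.mulVec_smul, Matrix.mulVec_smul,
    Matrix.mulVec_smul, afNambu_mulVec_planeWave_zero k hL, afNambu_mulVec_planeWave_one k hL,
    afNambu_mulVec_planeWave_one k hL, torusBand_add_neelIndex, dWaveGap_add_neelIndex, add_neelIndex_add_neelIndex]
  ext o
  simp only [Pi.add_apply, Pi.smul_apply, Pi.sub_apply, smul_eq_mul]
  push_cast
  ring

end AFSymbol

end Summit.Ventures.CertifiedManyBodySolver.Observables

end
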